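import Mathlib
import HarnessLib
import Literature.NumberTheory.LFunctions.ZetaScrew
import Summits.RiemannHypothesis.RiemannHypothesis.Theorems.IntegerScrewIncrementSharp
import Summits.RiemannHypothesis.RiemannHypothesis.Theorems.IntegerScrewIncrementCovariance
import Summits.RiemannHypothesis.RiemannHypothesis.Theorems.IntegerScrewTwoNodeBound
import Summits.RiemannHypothesis.RiemannHypothesis.Theorems.IntegerScrewPivotCriterion
import Summits.RiemannHypothesis.RiemannHypothesis.Theorems.IntegerScrewRung128

/-!
# Route `IntegerScrew` — a quantitative LOWER bound on the pivot deficit: `G(M) ≥ 1/(20 log M)`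
# (PIVOT-LAW §2a(iv) «two-node gain ≈ (log 2)²/(log m − c₀)», DERIVED → THEOREM; RH-FREE given
# `S_{M−1} ≻ 0`)

With `L(M) = M·2Ψ(h_M)` and `G(M) = L(M) − M·d_M ≥ 0` (`IntegerScrewPivotUpperBound`), the two-node
predictor (`IntegerScrewTwoNodeBound.screwPivot_add_four_le_twoNode_opt`) gives
`G(M) ≥ M·Cov(I_M,I_{M−1})²/(2Ψ(h_{M−1}))`; feeding the explicit laws `|M·Cov + log 2| ≤ 40/(M−2)`
(`IntegerScrewIncrementCovariance`) and `(M−1)·2Ψ(h_{M−1}) ≤ log(M−1) − c₀ + (log(M−1)+19)/(M−2)`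
(`IntegerScrewIncrementSharp`) yields, for `M ≥ 122` with `S_{M−1} ≻ 0`,
**`M·(2Ψ(h_M) − d_M) ≥ 1/(20·log M)`** — the first quantitative floor under the deficit (the measured
`G` is ≈ 0.5 on primes; the DERIVED asymptotic of this particular gain is `(log 2)²/(log M − c₀)`) —
and, with the sharp constant (PIVOT-LAW §15: the `K = 1` floor `S_1 = (log 2)²` of the continuum
constant `V/2 = ¼Σ_{k≥1}(Δ²[k log k])² = 0.64936`), **`G(M)·log M ≥ (log 2)² − 57/(M − 2)`**
(`deficit_mul_log_ge`) and its limit form `eventually_deficit_mul_log_ge`.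
Nothing here bears on the truth of RH. [Suzuki2023, (1.1)]
-/

noncomputable section

-- D-0017: `Summit.<S>.<S>.…` is the designed namespace of a single-problem summit.
set_option linter.dupNamespace false

namespace Summit.RiemannHypothesis.RiemannHypothesis.Theorems.IntegerScrew

open Literature.NumberTheory.LFunctions

/-- **Deficit floor from the two-node gain:** for `M ≥ 122` with `S_{M−1} = screwMatrix (M−2) ≻ 0`,
`M·(2Ψ(log(M/(M−1))) − d_M) ≥ 1/(20 log M)`. [folklore] -/
theorem deficit_ge_inv_twenty_log (M : ℕ) (hM : 122 ≤ M) (h : (screwMatrix (M - 2)).PosDef) :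
    1 / (20 * Real.log M) ≤
      (M : ℝ) * (2 * zetaScrew (Real.log ((M : ℝ) / ((M : ℝ) - 1))) - screwPivot M) := by
  obtain ⟨n, rfl⟩ : ∃ n, M = n + 4 := ⟨M - 4, by omega⟩
  have h42 : n + 4 - 2 = n + 2 := by omega
  rw [h42] at h
  have hn : (screwMatrix (n + 2)).PosDef := h
  -- the three inputs
  have h2 := screwPivot_add_four_le_twoNode_opt n hn
  have hcov := abs_incrementCov_add_log_two_le (n + 4) (by omega)
  have hL := abs_incrementEnergy_sub_le (n + 3) (by omega)
  -- names
  set m : ℝ := ((n + 4 : ℕ) : ℝ) with hm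
  have hm122 : (122 : ℝ) ≤ m := by rw [hm]; exact_mod_cast hM
  have e3 : ((n + 3 : ℕ) : ℝ) = m - 1 := by rw [hm]; push_cast; ring
  have e2 : ((n + 2 : ℕ) : ℝ) = m - 2 := by rw [hm]; push_cast; ring
  rw [e3, e2] at h2
  rw [e3] at hL
  have e31 : m - 1 - 1 = m - 2 := by ring
  rw [e31] at hL
  set P : ℝ := zetaScrew (Real.log (m / (m - 1))) with hP
  set R : ℝ := zetaScrew (Real.log ((m - 1) / (m - 2))) with hR
  set U : ℝ := zetaScrew (Real.log (m / (m - 2))) with hU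
  set Cv : ℝ := U - P - R with hCv
  set c₀ : ℝ := Real.log (2 * Real.pi) + Real.eulerMascheroniConstant - 1 with hc0
  -- positivity of R (0 < h' ≤ log 2)
  have hm2 : 0 < m - 2 := by linarith
  have hm1 : 0 < m - 1 := by linarith
  have hm0 : 0 < m := by linarith
  have hR0 : 0 < R := by
    apply Suzuki2023Thm41.zetaScrew_pos_of_le_log_two
    · apply Real.log_pos; rw [one_lt_div hm2]; linarith
    · apply Real.log_le_log (by positivity); rw [div_le_iff₀ hm2]; linarith
  -- c₀ ≥ 0
  have hc0lo : 0 ≤ c₀ := by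
    have h2pi : 0 < 2 * Real.pi := by positivity
    have : 1 < Real.log (2 * Real.pi) := by
      rw [Real.lt_log_iff_exp_lt h2pi]
      have := Real.exp_one_lt_d9; have := Real.pi_gt_three; linarith
    have := Real.one_half_lt_eulerMascheroniConstant
    rw [hc0]; linarith
  -- log bounds: 4 ≤ log(m−1) ≤ log m (122 ≥ e^4 = 54.6)
  have hlog1 : 4 ≤ Real.log (m - 1) := by
    rw [Real.le_log_iff_exp_le hm1]
    have he : Real.exp 1 < 272 / 100 := lt_trans Real.exp_one_lt_d9 (by norm_num)
    have he0 := Real.exp_pos (1 : ℝ)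
    have he2 : Real.exp 2 < 74 / 10 := by
      rw [show (2 : ℝ) = 1 + 1 by norm_num, Real.exp_add]
      have := mul_lt_mul'' he he he0.le he0.le
      linarith [show (272 / 100 : ℝ) * (272 / 100) < 74 / 10 by norm_num]
    have he20 := Real.exp_pos (2 : ℝ)
    have he4 : Real.exp 4 < 55 := by
      rw [show (4 : ℝ) = 2 + 2 by norm_num, Real.exp_add]
      have := mul_lt_mul'' he2 he2 he20.le he20.le
      linarith [show (74 / 10 : ℝ) * (74 / 10) < 55 by norm_num]
    linarith
  have hlogm : Real.log (m - 1) ≤ Real.log m := Real.log_le_log hm1 (by linarith)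
  have hlogm0 : 0 < Real.log m := by linarith
  -- Y := (m−1)·2R ≤ 2 log m
  have hY : (m - 1) * (2 * R) ≤ 2 * Real.log m := by
    rw [abs_le] at hL
    have hq : (Real.log (m - 1) + 19) / (m - 2) ≤ Real.log (m - 1) := by
      rw [div_le_iff₀ hm2]
      have : 4 * (m - 2) ≤ Real.log (m - 1) * (m - 2) := mul_le_mul_of_nonneg_right hlog1 hm2.le
      have hlu : Real.log (m - 1) ≤ (m - 1) - 1 := Real.log_le_sub_one_of_pos hm1
      linarith
    linarith [hL.2]
  -- X := m·Cv ≤ −(log 2 − 1/3) < 0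
  have hX : m * Cv ≤ -(Real.log 2 - 1 / 3) := by
    rw [abs_le] at hcov
    have : 40 / (m - 2) ≤ 1 / 3 := by rw [div_le_iff₀ hm2]; linarith
    have hcv' : m * (U - P - R) + Real.log 2 ≤ 40 / (m - 2) := hcov.2
    rw [← hCv] at hcv'
    linarith
  have hlog2 : (0.6931471803 : ℝ) < Real.log 2 := Real.log_two_gt_d9
  have hX1 : m * Cv ≤ -(7 / 20) := by linarith
  have hX2 : (7 / 20 : ℝ) ^ 2 ≤ (m * Cv) ^ 2 := by
    have h' : (7 / 20 : ℝ) ≤ -(m * Cv) := by linarith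
    have h'' : (7 / 20 : ℝ) ^ 2 ≤ (-(m * Cv)) ^ 2 := pow_le_pow_left₀ (by norm_num) h' 2
    simpa [neg_sq] using h''
  -- the gain: m·(2P − d) ≥ m·Cv²/(2R)
  have hgain : m * (Cv ^ 2 / (2 * R)) ≤ m * (2 * P - screwPivot (n + 4)) := by
    apply mul_le_mul_of_nonneg_left _ hm0.le
    linarith [h2]
  have hkey : (m * Cv) ^ 2 / (m * (2 * R)) = m * (Cv ^ 2 / (2 * R)) := by
    field_simp
  -- lower bound the left side
  have hden : m * (2 * R) ≤ m * (2 * Real.log m / (m - 1)) := by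
    apply mul_le_mul_of_nonneg_left _ hm0.le
    rw [le_div_iff₀ hm1]; linarith
  have hden0 : 0 < m * (2 * R) := by positivity
  have step1 : (7 / 20 : ℝ) ^ 2 / (m * (2 * Real.log m / (m - 1))) ≤ (m * Cv) ^ 2 / (m * (2 * R)) := by
    calc (7 / 20 : ℝ) ^ 2 / (m * (2 * Real.log m / (m - 1)))
        ≤ (7 / 20 : ℝ) ^ 2 / (m * (2 * R)) := by
          apply div_le_div_of_nonneg_left (by norm_num) hden0 hden
      _ ≤ (m * Cv) ^ 2 / (m * (2 * R)) := by
          apply div_le_div_of_nonneg_right hX2 hden0.le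
  have step0 : 1 / (20 * Real.log m) ≤ (7 / 20 : ℝ) ^ 2 / (m * (2 * Real.log m / (m - 1))) := by
    rw [div_le_div_iff₀ (by positivity) (by positivity)]
    -- 1·(m·(2 log m/(m−1))) ≤ (49/400)·20·log m = 2.45 log m  ⟸  2m/(m−1) ≤ 2.45
    have hfrac : m * (2 * Real.log m / (m - 1)) = (2 * m / (m - 1)) * Real.log m := by
      field_simp
    rw [hfrac]
    have h2m : 2 * m / (m - 1) ≤ 49 / 20 := by
      rw [div_le_iff₀ hm1]; linarith
    have := mul_le_mul_of_nonneg_right h2m hlogm0.le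
    linarith
  calc 1 / (20 * Real.log m) ≤ (7 / 20 : ℝ) ^ 2 / (m * (2 * Real.log m / (m - 1))) := step0
    _ ≤ (m * Cv) ^ 2 / (m * (2 * R)) := step1
    _ = m * (Cv ^ 2 / (2 * R)) := hkey
    _ ≤ m * (2 * P - screwPivot (n + 4)) := hgain

/-- Unconditionally for `122 ≤ M ≤ 129` (kernel rungs `S_n ≻ 0`, `n ≤ 127`). [folklore] -/
theorem deficit_ge_inv_twenty_log_of_le (M : ℕ) (hM : 122 ≤ M) (hM' : M ≤ 129) :
    1 / (20 * Real.log M) ≤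
      (M : ℝ) * (2 * zetaScrew (Real.log ((M : ℝ) / ((M : ℝ) - 1))) - screwPivot M) :=
  deficit_ge_inv_twenty_log M hM (screwMatrix_posDef_of_le_127 (by omega))

/-- Under RH, for every `M ≥ 122`: `G(M) ≥ 1/(20 log M)`. [folklore] -/
theorem deficit_ge_inv_twenty_log_of_riemannHypothesis (hRH : _root_.RiemannHypothesis) (M : ℕ)
    (hM : 122 ≤ M) :
    1 / (20 * Real.log M) ≤
      (M : ℝ) * (2 * zetaScrew (Real.log ((M : ℝ) / ((M : ℝ) - 1))) - screwPivot M) :=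
  deficit_ge_inv_twenty_log M hM (screwMatrix_posDef_of_riemannHypothesis hRH (M - 2))

/-! ### The sharp two-node constant: `G(M)·log M ≥ (log 2)² − 57/(M − 2)` (PIVOT-LAW §15, `S_1 = (log 2)²`) -/

/-- **Deficit floor with the sharp two-node constant:** for `M ≥ 122` with `S_{M−1} ≻ 0`,
`(log 2)² − 57/(M − 2) ≤ M·(2Ψ(log(M/(M−1))) − d_M)·log M` — the `K = 1` floor `S_1 = (log 2)²` of
PIVOT-LAW §15.3 with an explicit rate (`G·log M ≥ (log 2 − 40/(M−2))²·(1 − 1/M)` from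
`|M·Cov + log 2| ≤ 40/(M−2)`, `(M−1)·2Ψ(h_{M−1}) ≤ log M`, and the two-node gain). [folklore] -/
theorem deficit_mul_log_ge (M : ℕ) (hM : 122 ≤ M) (h : (screwMatrix (M - 2)).PosDef) :
    Real.log 2 ^ 2 - 57 / ((M : ℝ) - 2) ≤
      (M : ℝ) * (2 * zetaScrew (Real.log ((M : ℝ) / ((M : ℝ) - 1))) - screwPivot M)
        * Real.log M := by
  obtain ⟨n, rfl⟩ : ∃ n, M = n + 4 := ⟨M - 4, by omega⟩
  have h42 : n + 4 - 2 = n + 2 := by omega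
  rw [h42] at h
  have hn : (screwMatrix (n + 2)).PosDef := h
  have h2 := screwPivot_add_four_le_twoNode_opt n hn
  have hcov := abs_incrementCov_add_log_two_le (n + 4) (by omega)
  have hL := abs_incrementEnergy_sub_le (n + 3) (by omega)
  set m : ℝ := ((n + 4 : ℕ) : ℝ) with hm
  have hm122 : (122 : ℝ) ≤ m := by rw [hm]; exact_mod_cast hM
  have e3 : ((n + 3 : ℕ) : ℝ) = m - 1 := by rw [hm]; push_cast; ring
  have e2 : ((n + 2 : ℕ) : ℝ) = m - 2 := by rw [hm]; push_cast; ring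
  rw [e3, e2] at h2
  rw [e3] at hL
  have e31 : m - 1 - 1 = m - 2 := by ring
  rw [e31] at hL
  set P : ℝ := zetaScrew (Real.log (m / (m - 1))) with hP
  set R : ℝ := zetaScrew (Real.log ((m - 1) / (m - 2))) with hR
  set U : ℝ := zetaScrew (Real.log (m / (m - 2))) with hU
  set Cv : ℝ := U - P - R with hCv
  set c₀ : ℝ := Real.log (2 * Real.pi) + Real.eulerMascheroniConstant - 1 with hc0
  have hm2 : 0 < m - 2 := by linarith
  have hm1 : 0 < m - 1 := by linarith
  have hm0 : 0 < m := by linarith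
  have hR0 : 0 < R := by
    apply Suzuki2023Thm41.zetaScrew_pos_of_le_log_two
    · apply Real.log_pos; rw [one_lt_div hm2]; linarith
    · apply Real.log_le_log (by positivity); rw [div_le_iff₀ hm2]; linarith
  -- c₀ ≥ 1/2
  have hc0lo : 1 / 2 ≤ c₀ := by
    have h2pi : 0 < 2 * Real.pi := by positivity
    have : 1 < Real.log (2 * Real.pi) := by
      rw [Real.lt_log_iff_exp_lt h2pi]
      have := Real.exp_one_lt_d9; have := Real.pi_gt_three; linarith
    have := Real.one_half_lt_eulerMascheroniConstant
    rw [hc0]; linarith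
  have hlog2 : (0.6931471803 : ℝ) < Real.log 2 := Real.log_two_gt_d9
  have hlog2' : Real.log 2 < 0.6931471808 := Real.log_two_lt_d9
  -- log m ≤ m/64 + 3.16 (log x ≤ x − 1 at x = m/64), hence (log m + 19)/(m − 2) ≤ 1/2 ≤ c₀
  have hlogm_lin : Real.log m ≤ m / 64 + 316 / 100 := by
    have h64 : Real.log m = Real.log (m / 64) + 6 * Real.log 2 := by
      rw [Real.log_div hm0.ne' (by norm_num), show (64 : ℝ) = 2 ^ 6 by norm_num, Real.log_pow]
      push_cast; ring
    have := Real.log_le_sub_one_of_pos (by positivity : 0 < m / 64)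
    rw [h64]; linarith
  have hlogm : Real.log (m - 1) ≤ Real.log m := Real.log_le_log hm1 (by linarith)
  have hlogm0 : 0 < Real.log m := by
    have : 1 < m := by linarith
    exact Real.log_pos this
  have hq : (Real.log (m - 1) + 19) / (m - 2) ≤ c₀ := by
    rw [div_le_iff₀ hm2]
    have h1 : 1 / 2 * (m - 2) ≤ c₀ * (m - 2) := mul_le_mul_of_nonneg_right hc0lo hm2.le
    linarith
  -- Y := (m−1)·2R ≤ log m
  have hY : (m - 1) * (2 * R) ≤ Real.log m := by
    rw [abs_le] at hL
    linarith [hL.2]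
  -- X := m·Cv ≤ −(log 2 − a), a = 40/(m−2) ≤ 1/3
  set a : ℝ := 40 / (m - 2) with ha
  have ha0 : 0 ≤ a := by positivity
  have ha3 : a ≤ 1 / 3 := by rw [ha, div_le_iff₀ hm2]; linarith
  have hX : m * Cv ≤ -(Real.log 2 - a) := by
    rw [abs_le] at hcov
    have hcv' : m * (U - P - R) + Real.log 2 ≤ 40 / (m - 2) := hcov.2
    rw [← hCv, ← ha] at hcv'
    linarith
  have hla : 0 < Real.log 2 - a := by linarith
  have hX2 : (Real.log 2 - a) ^ 2 ≤ (m * Cv) ^ 2 := by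
    have h' : Real.log 2 - a ≤ -(m * Cv) := by linarith
    have h'' := pow_le_pow_left₀ hla.le h' 2
    simpa [neg_sq] using h''
  -- the gain: G ≥ (m·Cv)²/(m·2R) ≥ (log 2 − a)²·(m−1)/(m·log m)
  have hgain : m * (Cv ^ 2 / (2 * R)) ≤ m * (2 * P - screwPivot (n + 4)) := by
    apply mul_le_mul_of_nonneg_left _ hm0.le
    linarith [h2]
  have hkey : (m * Cv) ^ 2 / (m * (2 * R)) = m * (Cv ^ 2 / (2 * R)) := by
    field_simp
  have hden : m * (2 * R) ≤ m * (Real.log m / (m - 1)) := by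
    apply mul_le_mul_of_nonneg_left _ hm0.le
    rw [le_div_iff₀ hm1]; linarith
  have hden0 : 0 < m * (2 * R) := by positivity
  have hG : (Real.log 2 - a) ^ 2 / (m * (Real.log m / (m - 1)))
      ≤ m * (2 * P - screwPivot (n + 4)) := by
    calc (Real.log 2 - a) ^ 2 / (m * (Real.log m / (m - 1)))
        ≤ (Real.log 2 - a) ^ 2 / (m * (2 * R)) :=
          div_le_div_of_nonneg_left (sq_nonneg _) hden0 hden
      _ ≤ (m * Cv) ^ 2 / (m * (2 * R)) := div_le_div_of_nonneg_right hX2 hden0.le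
      _ = m * (Cv ^ 2 / (2 * R)) := hkey
      _ ≤ m * (2 * P - screwPivot (n + 4)) := hgain
  -- multiply by log m: G·log m ≥ (log 2 − a)²·(m−1)/m
  have hGlog : (Real.log 2 - a) ^ 2 * ((m - 1) / m)
      ≤ m * (2 * P - screwPivot (n + 4)) * Real.log m := by
    have := mul_le_mul_of_nonneg_right hG hlogm0.le
    have e : (Real.log 2 - a) ^ 2 / (m * (Real.log m / (m - 1))) * Real.log m
        = (Real.log 2 - a) ^ 2 * ((m - 1) / m) := by
      field_simp
    rw [e] at this
    exact this
  -- arithmetic: (log 2)² − 57/(m−2) ≤ (log 2 − a)²·(1 − 1/m)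
  have hfrac : (m - 1) / m = 1 - 1 / m := by field_simp
  have h1m : 1 / m ≤ 1 / (m - 2) := one_div_le_one_div_of_le hm2 (by linarith)
  have h1m0 : 0 ≤ 1 / m := by positivity
  have hsq : Real.log 2 ^ 2 - 2 * a * Real.log 2 ≤ (Real.log 2 - a) ^ 2 := by
    have e : (Real.log 2 - a) ^ 2 = Real.log 2 ^ 2 - 2 * a * Real.log 2 + a ^ 2 := by ring
    rw [e]; linarith [sq_nonneg a]
  have hl1 : Real.log 2 ^ 2 ≤ 1 := pow_le_one₀ (by linarith) (by linarith)
  have harith : Real.log 2 ^ 2 - 57 / (m - 2) ≤ (Real.log 2 - a) ^ 2 * ((m - 1) / m) := by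
    rw [hfrac]
    -- (log 2 − a)²(1 − 1/m) ≥ (log2² − 2a·log2)(1 − 1/m) ≥ log2² − 2a·log2 − log2²/m
    have step1 : (Real.log 2 ^ 2 - 2 * a * Real.log 2) * (1 - 1 / m)
        ≤ (Real.log 2 - a) ^ 2 * (1 - 1 / m) :=
      mul_le_mul_of_nonneg_right hsq (by rw [← hfrac]; positivity)
    have step2 : Real.log 2 ^ 2 - 2 * a * Real.log 2 - Real.log 2 ^ 2 * (1 / m)
        ≤ (Real.log 2 ^ 2 - 2 * a * Real.log 2) * (1 - 1 / m) := by
      have : 0 ≤ 2 * a * Real.log 2 * (1 / m) := by positivity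
      have e : (Real.log 2 ^ 2 - 2 * a * Real.log 2) * (1 - 1 / m)
          = Real.log 2 ^ 2 - 2 * a * Real.log 2 - Real.log 2 ^ 2 * (1 / m)
            + 2 * a * Real.log 2 * (1 / m) := by ring
      rw [e]; linarith
    -- 2a·log 2 + log2²/m ≤ (80 log 2 + 1)/(m−2) ≤ 57/(m−2)
    have step3 : 2 * a * Real.log 2 + Real.log 2 ^ 2 * (1 / m) ≤ 57 / (m - 2) := by
      have e80 : 2 * a * Real.log 2 = 80 * Real.log 2 * (1 / (m - 2)) := by rw [ha]; ring
      rw [e80]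
      have hb : Real.log 2 ^ 2 * (1 / m) ≤ 1 * (1 / (m - 2)) :=
        mul_le_mul hl1 h1m h1m0 (by norm_num)
      have e57 : (57 : ℝ) / (m - 2) = 57 * (1 / (m - 2)) := by ring
      rw [e57]
      have h0 : 0 ≤ 1 / (m - 2) := by positivity
      have hprod : Real.log 2 * (1 / (m - 2)) ≤ 0.6931471808 * (1 / (m - 2)) :=
        mul_le_mul_of_nonneg_right hlog2'.le h0
      linarith
    linarith
  exact harith.trans hGlog

/-- The sharp floor unconditionally for `122 ≤ M ≤ 129` (kernel rungs). [folklore] -/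
theorem deficit_mul_log_ge_of_le (M : ℕ) (hM : 122 ≤ M) (hM' : M ≤ 129) :
    Real.log 2 ^ 2 - 57 / ((M : ℝ) - 2) ≤
      (M : ℝ) * (2 * zetaScrew (Real.log ((M : ℝ) / ((M : ℝ) - 1))) - screwPivot M)
        * Real.log M :=
  deficit_mul_log_ge M hM (screwMatrix_posDef_of_le_127 (by omega))

/-- Under RH, for every `M ≥ 122`: `G(M)·log M ≥ (log 2)² − 57/(M − 2)`. [folklore] -/
theorem deficit_mul_log_ge_of_riemannHypothesis (hRH : _root_.RiemannHypothesis) (M : ℕ)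
    (hM : 122 ≤ M) :
    Real.log 2 ^ 2 - 57 / ((M : ℝ) - 2) ≤
      (M : ℝ) * (2 * zetaScrew (Real.log ((M : ℝ) / ((M : ℝ) - 1))) - screwPivot M)
        * Real.log M :=
  deficit_mul_log_ge M hM (screwMatrix_posDef_of_riemannHypothesis hRH (M - 2))

/-- **The two-node floor in limit form** (PIVOT-LAW §15.3, `K = 1`): for every `ε > 0`, eventually
in `M`, `S_{M−1} ≻ 0 → (log 2)² − ε ≤ G(M)·log M`. [folklore] -/
theorem eventually_deficit_mul_log_ge (ε : ℝ) (hε : 0 < ε) :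
    ∀ᶠ M : ℕ in Filter.atTop, (screwMatrix (M - 2)).PosDef →
      Real.log 2 ^ 2 - ε ≤
        (M : ℝ) * (2 * zetaScrew (Real.log ((M : ℝ) / ((M : ℝ) - 1))) - screwPivot M)
          * Real.log M := by
  have h57 : Filter.Tendsto (fun M : ℕ => (57 : ℝ) / ((M : ℝ) - 2)) Filter.atTop (nhds 0) := by
    refine tendsto_const_nhds.div_atTop ?_
    have := Filter.tendsto_atTop_add_const_right Filter.atTop (-2 : ℝ) tendsto_natCast_atTop_atTop
    simpa [sub_eq_add_neg] using this
  filter_upwards [Filter.eventually_ge_atTop 122, h57.eventually (gt_mem_nhds hε)] with M hM hlt hPD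
  have := deficit_mul_log_ge M hM hPD
  linarith

end Summit.RiemannHypothesis.RiemannHypothesis.Theorems.IntegerScrew
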